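import Summits.ResolutionOfSingularities.ResolutionOfSingularities.Theorems.FrobeniusClosingPatchingRelPerfectDepthConeVertexResolvableOf
import Summits.ResolutionOfSingularities.ResolutionOfSingularities.Theorems.FrobeniusClosingPatchingRelPerfectDepthConeVertexCharts
import Summits.ResolutionOfSingularities.ResolutionOfSingularities.Theorems.FrobeniusClosingPatchingRelPerfectDepthConeVertexTransform
import HarnessLib

/-!
# Crux `PatchingRelPerfect` (stmt-ResolutionOfSingularities-16161), chain W5.2 — TargetsF4 §5, E-side target
# `DepthTargets.ConeVertexResolvable ℓ` CLOSED BY NAME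

[OURS · L1 W5.2 · TargetsF4 §5] plan-1 g7 STEER 06:34:44Z (B) (res-type-003 holds `coneVertexResolvable_holds`), split
with res-D-pv-021 g6: the typed target `ConeVertexResolvable ℓ` (`…DepthGradedTargets`, p507151) — for a non-zero form
`F` of degree `ℓ` on `ℙ^m` whose form ideal sheaf has order `≤ 1` everywhere, the form ideal sheaf of the cone
`G = F(T₀,…,T_m) ⊂ ℙ^{m+1}` is `PureResolvable ℓ` — from the assembly `coneVertexResolvable_of`
(`…DepthConeVertexResolvableOf`, p509363: ONE weight-`ℓ` blowing up of the reduced vertex) fed with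
res-D-pv-021's (5) permissibility `𝓟_G ≤ 𝓘_v^ℓ` (`DepthCone.projIdealSheaf_cone_le_vertexIdealSheaf_pow`,
`…DepthConeVertexCharts`, p510165) and corollaries of the transform identity
`𝔟' = 𝓟_F · 𝒪` along the smooth projection `Bl_v ℙ^{m+1} → ℙ^m` (`…DepthConeVertexTransform`):
(3) `DepthCone.idealOrder_controlledTransform_cone_le_one` and (4) `DepthCone.isLocallyPrincipal_controlledTransform_cone`.
Fact-free; nothing here is a statement of the manuscript under review; AI-written, AI review is weaker than expert review.

## References
* A. J. de Jong, *Smoothness, semi-stability and alterations*, Publ. IHÉS 83 (1996), Lemma 4.11 (proof), p. 68. [DeJong1996]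
* J. Kollár, *Lectures on Resolution of Singularities* (2007), 3.30.2. [Kollar2007]
-/

-- `Summit.<Summit>.<Sub>.Theorems` with `Sub = Summit` (single-conjunct summit, D-0017)
set_option linter.dupNamespace false

noncomputable section

open CategoryTheory AlgebraicGeometry
open Literature.AlgebraicGeometry.Resolution Literature.AlgebraicGeometry.Resolution.DeJong1996

namespace Summit.ResolutionOfSingularities.ResolutionOfSingularities.Theorems.DepthTargets

universe u

/-- **TargetsF4 §5 by name — the cone over a resolvable form is purely resolvable with weight `ℓ`**: one weight-`ℓ`
blowing up of the vertex of `ℙ^{m+1}` turns the form ideal sheaf of the cone `G = F(T₀,…,T_m)` into the pull-back of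
`(F)~` along the smooth projection to `ℙ^m`, locally principal and of order `≤ 1` everywhere.
[cite: DeJong1996, Lemma 4.11 (proof), p. 68] [cite: Kollar2007, 3.30.2] -/
theorem coneVertexResolvable_holds (ℓ : ℕ) : ConeVertexResolvable.{u} ℓ :=
  coneVertexResolvable_of ℓ
    (fun κ₀ _ m F hF _ hG hGF => DepthCone.projIdealSheaf_cone_le_vertexIdealSheaf_pow κ₀ m ℓ F hF hG hGF)
    (fun κ₀ _ m F hF hreg _ hG hGF _ _ _ _ hb x =>
      DepthCone.idealOrder_controlledTransform_cone_le_one κ₀ m ℓ F hF hreg hG hGF hb x)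
    (fun κ₀ _ m F hF hlp _ hG hGF _ _ _ _ hb =>
      DepthCone.isLocallyPrincipal_controlledTransform_cone κ₀ m ℓ F hF hlp hG hGF hb)

end Summit.ResolutionOfSingularities.ResolutionOfSingularities.Theorems.DepthTargets

end
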